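import Mathlib
import Summits.Ventures.PercRepro2.TB14Hall

/-!
# Row 2′TB (typed BHK 1.4 single-vertex): THE ROW AS TWO COUNT INEQUALITIES (J1) + (J2), and the
region-swap identity behind (J2) (blind cell PercRepro2, p5 g5, 2026-08-25; P5-RULES.md §6.9)

At a profile «`F` free, `z` pinned» the admissible sources `srcSet` / targets `tgtSet` of
`TB14Hall` split by the place of `b` relative to the second-copy cluster of `a₂`:

* J1 = «`b ∈ C₂(flipOn F y)`» (at the all-free profile: `b` in the blue-only part of `a₂`, since
  `b ∉ C₂(y)` is automatic for a source or a target — `not_conn_a2_b_of_isSrc`);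
* J2 = «`b ∉ C₂(flipOn F y)`» (`b` outside the region of `a₂`).

`tb14_of_counts`: the two COUNT inequalities `#J1src ≤ #J1tgt` and `#J2src ≤ #J2tgt` give the row
(no matching, no Hall condition). Behind (J2) stands an IDENTITY: without the hypothesis
`b ~ a₁`, the region swap `ι₂ = swapRegion` (TB14Fold) is a bijection between the admissible
configurations with `Q`, `b` outside the region and `o` in the first cluster only, and those with
`o` in the second cluster only (`card_outA_eq_card_outB`); `J2src ⊆ outA`, `J2tgt ⊆ outB`, so (J2)
says exactly that `ι₂` loses the link `b ~ a₁` at least as often as it creates it.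

Census (P5-RULES.md §6.9): both count inequalities hold on every connected graph with `n ≤ 7`
vertices (all `m`) and `n = 8`, `m ≤ 10`, and the identity is exact there. Nothing here proves
(J1) or (J2); standard axioms.
-/

namespace Summit.Ventures.PercRepro2

namespace TB14Counts

open CovForm A3InactiveTyped TB14Fold TB14FlipFamily TB14Hall

section Split

variable {V : Type} {E : Type} [Fintype E] [DecidableEq E]
variable {R : Type*} [Field R] [LinearOrder R] [IsStrictOrderedRing R]
variable (ends : E → Sym2 V) (a₁ a₂ b o : V) (F : Finset E) (z : Config E)

omit [Fintype E] in
/-- For a source, `b` is not in the first-copy cluster of `a₂` (else `a₁ ~ a₂` through `b`). -/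
lemma not_conn_a2_b_of_isSrc {y : Config E} (hs : IsSrc ends a₁ a₂ b o F y) :
    ¬ Conn ends y a₂ b :=
  fun h => hs.q₁ (conn_trans hs.hb (conn_symm h))

omit [Fintype E] in
/-- For a target, `b` is not in the first-copy cluster of `a₂`. -/
lemma not_conn_a2_b_of_isTgt {y : Config E} (ht : IsTgt ends a₁ a₂ b o F y) :
    ¬ Conn ends y a₂ b :=
  fun h => ht.q₁ (conn_trans ht.hb (conn_symm h))

open Classical in
/-- The J1 sources: admissible sources with `b` in the second-copy cluster of `a₂`. -/
noncomputable def J1src : Finset (Config E) :=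
  (srcSet ends a₁ a₂ b o F z).filter fun y => Conn ends (A3InactiveTyped.flipOn F y) a₂ b

open Classical in
/-- The J2 sources: admissible sources with `b` outside the second-copy cluster of `a₂`. -/
noncomputable def J2src : Finset (Config E) :=
  (srcSet ends a₁ a₂ b o F z).filter fun y => ¬ Conn ends (A3InactiveTyped.flipOn F y) a₂ b

open Classical in
/-- The J1 targets. -/
noncomputable def J1tgt : Finset (Config E) :=
  (tgtSet ends a₁ a₂ b o F z).filter fun y => Conn ends (A3InactiveTyped.flipOn F y) a₂ b

open Classical in
/-- The J2 targets. -/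
noncomputable def J2tgt : Finset (Config E) :=
  (tgtSet ends a₁ a₂ b o F z).filter fun y => ¬ Conn ends (A3InactiveTyped.flipOn F y) a₂ b

open Classical in
/-- The sources split into the two classes. -/
lemma card_src_split :
    (srcSet ends a₁ a₂ b o F z).card =
      (J1src ends a₁ a₂ b o F z).card + (J2src ends a₁ a₂ b o F z).card := by
  unfold J1src J2src
  exact (Finset.card_filter_add_card_filter_not _).symm

open Classical in
/-- The targets split into the two classes. -/
lemma card_tgt_split :
    (tgtSet ends a₁ a₂ b o F z).card =
      (J1tgt ends a₁ a₂ b o F z).card + (J2tgt ends a₁ a₂ b o F z).card := by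
  unfold J1tgt J2tgt
  exact (Finset.card_filter_add_card_filter_not _).symm

/-- **(J1) ∧ (J2) ⟹ THE ROW**: the two count inequalities give the (TB14) inequality at the
profile. -/
theorem tb14_of_counts
    (h1 : (J1src ends a₁ a₂ b o F z).card ≤ (J1tgt ends a₁ a₂ b o F z).card)
    (h2 : (J2src ends a₁ a₂ b o F z).card ≤ (J2tgt ends a₁ a₂ b o F z).card) :
    pairCount F z (sameBO ends a₁ a₂ b o : Config E → Config E → R) ≤
      pairCount F z (crossBO ends a₁ a₂ b o) := by
  apply tb14_of_card_le
  rw [card_src_split, card_tgt_split]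
  omega

end Split

section Identity

variable {V : Type} {E : Type} [Fintype E] [DecidableEq E]
variable (ends : E → Sym2 V) (a₁ a₂ b o : V) (F : Finset E) (z : Config E)

omit [Fintype E] in
/-- `a₂ ~ v` in `ι₂ y` iff `a₂ ~ v` in the second copy of `y` (`cluster_swapRegion`). -/
lemma conn_swap_iff (y : Config E) (v : V) :
    Conn ends (swapRegion ends F a₂ y) a₂ v ↔ Conn ends (A3InactiveTyped.flipOn F y) a₂ v := by
  change v ∈ cluster ends (swapRegion ends F a₂ y) a₂ ↔ v ∈ cluster ends (A3InactiveTyped.flipOn F y) a₂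
  rw [cluster_swapRegion]

omit [Fintype E] in
/-- `a₂ ~ v` in the second copy of `ι₂ y` iff `a₂ ~ v` in `y` (`cluster_flip_swapRegion`). -/
lemma conn_flip_swap_iff (y : Config E) (v : V) :
    Conn ends (A3InactiveTyped.flipOn F (swapRegion ends F a₂ y)) a₂ v ↔ Conn ends y a₂ v := by
  change v ∈ cluster ends (A3InactiveTyped.flipOn F (swapRegion ends F a₂ y)) a₂ ↔ v ∈ cluster ends y a₂
  rw [cluster_flip_swapRegion]

omit [Fintype E] in
/-- `a₁ ~ a₂` in `ι₂ y` iff in the second copy of `y`. -/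
lemma conn_roots_swap_iff (y : Config E) :
    Conn ends (swapRegion ends F a₂ y) a₁ a₂ ↔ Conn ends (A3InactiveTyped.flipOn F y) a₁ a₂ :=
  ⟨fun h => conn_symm ((conn_swap_iff ends a₂ F y a₁).1 (conn_symm h)),
    fun h => conn_symm ((conn_swap_iff ends a₂ F y a₁).2 (conn_symm h))⟩

omit [Fintype E] in
/-- `a₁ ~ a₂` in the second copy of `ι₂ y` iff in `y`. -/
lemma conn_roots_flip_swap_iff (y : Config E) :
    Conn ends (A3InactiveTyped.flipOn F (swapRegion ends F a₂ y)) a₁ a₂ ↔ Conn ends y a₁ a₂ :=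
  ⟨fun h => conn_symm ((conn_flip_swap_iff ends a₂ F y a₁).1 (conn_symm h)),
    fun h => conn_symm ((conn_flip_swap_iff ends a₂ F y a₁).2 (conn_symm h))⟩

open Classical in
/-- Admissible configurations with `Q`, `b` outside the region of `a₂`, and `o` in the first
cluster of `a₂` only — NO condition on `b ~ a₁`. -/
noncomputable def outA : Finset (Config E) :=
  Finset.univ.filter fun y => (∀ e, e ∉ F → y e = z e) ∧
    ¬ Conn ends y a₁ a₂ ∧ ¬ Conn ends (A3InactiveTyped.flipOn F y) a₁ a₂ ∧
    ¬ Conn ends y a₂ b ∧ ¬ Conn ends (A3InactiveTyped.flipOn F y) a₂ b ∧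
    Conn ends y a₂ o ∧ ¬ Conn ends (A3InactiveTyped.flipOn F y) a₂ o

open Classical in
/-- The same with `o` in the second cluster of `a₂` only. -/
noncomputable def outB : Finset (Config E) :=
  Finset.univ.filter fun y => (∀ e, e ∉ F → y e = z e) ∧
    ¬ Conn ends y a₁ a₂ ∧ ¬ Conn ends (A3InactiveTyped.flipOn F y) a₁ a₂ ∧
    ¬ Conn ends y a₂ b ∧ ¬ Conn ends (A3InactiveTyped.flipOn F y) a₂ b ∧
    Conn ends (A3InactiveTyped.flipOn F y) a₂ o ∧ ¬ Conn ends y a₂ o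

open Classical in
/-- `ι₂` sends `outA` into `outB`. -/
lemma swapRegion_mem_outB {y : Config E} (hy : y ∈ outA ends a₁ a₂ b o F z) :
    swapRegion ends F a₂ y ∈ outB ends a₁ a₂ b o F z := by
  simp only [outA, outB, Finset.mem_filter, Finset.mem_univ, true_and] at hy ⊢
  obtain ⟨hz, q₁, q₂, hb₁, hb₂, ho₁, ho₂⟩ := hy
  refine ⟨(agree_swapRegion_iff ends F a₂ y z).2 hz, ?_, ?_, ?_, ?_, ?_, ?_⟩
  · exact fun h => q₂ ((conn_roots_swap_iff ends a₁ a₂ F y).1 h)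
  · exact fun h => q₁ ((conn_roots_flip_swap_iff ends a₁ a₂ F y).1 h)
  · exact fun h => hb₂ ((conn_swap_iff ends a₂ F y b).1 h)
  · exact fun h => hb₁ ((conn_flip_swap_iff ends a₂ F y b).1 h)
  · exact (conn_flip_swap_iff ends a₂ F y o).2 ho₁
  · exact fun h => ho₂ ((conn_swap_iff ends a₂ F y o).1 h)

open Classical in
/-- `ι₂` sends `outB` into `outA`. -/
lemma swapRegion_mem_outA {y : Config E} (hy : y ∈ outB ends a₁ a₂ b o F z) :
    swapRegion ends F a₂ y ∈ outA ends a₁ a₂ b o F z := by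
  simp only [outA, outB, Finset.mem_filter, Finset.mem_univ, true_and] at hy ⊢
  obtain ⟨hz, q₁, q₂, hb₁, hb₂, ho₂, ho₁⟩ := hy
  refine ⟨(agree_swapRegion_iff ends F a₂ y z).2 hz, ?_, ?_, ?_, ?_, ?_, ?_⟩
  · exact fun h => q₂ ((conn_roots_swap_iff ends a₁ a₂ F y).1 h)
  · exact fun h => q₁ ((conn_roots_flip_swap_iff ends a₁ a₂ F y).1 h)
  · exact fun h => hb₂ ((conn_swap_iff ends a₂ F y b).1 h)
  · exact fun h => hb₁ ((conn_flip_swap_iff ends a₂ F y b).1 h)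
  · exact (conn_swap_iff ends a₂ F y o).2 ho₂
  · exact fun h => ho₁ ((conn_flip_swap_iff ends a₂ F y o).1 h)

open Classical in
/-- **THE REGION-SWAP IDENTITY**: without the hypothesis `b ~ a₁`, «`o` in the first cluster
only» and «`o` in the second cluster only» (with `Q` and `b` outside the region) are equinumerous
— `ι₂` is a bijection between them. -/
theorem card_outA_eq_card_outB :
    (outA ends a₁ a₂ b o F z).card = (outB ends a₁ a₂ b o F z).card := by
  refine Finset.card_bij (fun y _ => swapRegion ends F a₂ y)
    (fun y hy => swapRegion_mem_outB ends a₁ a₂ b o F z hy) ?_ ?_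
  · intro y _ y' _ h
    have := congrArg (swapRegion ends F a₂) h
    rwa [swapRegion_swapRegion, swapRegion_swapRegion] at this
  · intro w hw
    exact ⟨swapRegion ends F a₂ w, swapRegion_mem_outA ends a₁ a₂ b o F z hw,
      swapRegion_swapRegion ends F a₂ w⟩

open Classical in
/-- The J2 sources are `outA`-configurations (with `b ~ a₁` on top). -/
lemma J2src_subset_outA : J2src ends a₁ a₂ b o F z ⊆ outA ends a₁ a₂ b o F z := by
  intro y hy
  simp only [J2src, srcSet, Finset.mem_filter, Finset.mem_univ, true_and] at hy
  obtain ⟨⟨hz, hs⟩, hb₂⟩ := hy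
  simp only [outA, Finset.mem_filter, Finset.mem_univ, true_and]
  exact ⟨hz, hs.q₁, hs.q₂, not_conn_a2_b_of_isSrc ends a₁ a₂ b o F hs, hb₂, hs.ho, hs.ho'⟩

open Classical in
/-- The J2 targets are `outB`-configurations. -/
lemma J2tgt_subset_outB : J2tgt ends a₁ a₂ b o F z ⊆ outB ends a₁ a₂ b o F z := by
  intro y hy
  simp only [J2tgt, tgtSet, Finset.mem_filter, Finset.mem_univ, true_and] at hy
  obtain ⟨⟨hz, ht⟩, hb₂⟩ := hy
  simp only [outB, Finset.mem_filter, Finset.mem_univ, true_and]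
  exact ⟨hz, ht.q₁, ht.q₂, not_conn_a2_b_of_isTgt ends a₁ a₂ b o F ht, hb₂, ht.ho, ht.ho'⟩

end Identity

end TB14Counts

end Summit.Ventures.PercRepro2
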